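import Summits.QuantumFields.YangMills.Theorems.BalabanUVNodesN07Thm4Rows152OfRecordDoorRows
import Summits.QuantumFields.YangMills.Theorems.BalabanUVNodesN07Thm4RecordStructureSym152PhiEG
import Summits.QuantumFields.YangMills.Theorems.BalabanUVNodesN07NrmSymPhiOfCoverRow
import HarnessLib

/-!
# N07 [B11] (= [15] = [Balaban1985Variational]) Sect. F — MODULE 133′ (W2″ GLUED; supersedes MODULE 133 ✓p760315 `…N07Thm4RecSym152PhiEGOfJunction`, which stays in the tree
# byte-identical): **THE ASSEMBLY SKELETON OF THE DEF OF RECORD (β′) `HThm4RecSym152PhiEG` FROM THE PRE-COMPOSED CROWN AND A PER-DATUM ROW-9′ SUPPLIER — WITH THE LEVEL-0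
# GLUE RESTORED**: `hJ`'s last clause now asks row 9′ for SOME gauge `u′` agreeing with the door's `u` on `π″(□₀)` (`cover '' cube … j 0`), not for `u` itself

Cell `pub-ymgap`, seat `pub-ymgap-dag-n07-e` g33 (FAN-OUT §N07 row s3; LANE OWNER of the K0 road chart side; author of 133 and of the def of record ✓p752342).  `--kind proof --supports
stmt-QuantumFields-20541 --as helper` (K0⁷; count-neutral).  ONE theorem, 0 `def`.  [15] = [Balaban1985Variational]; [6] = [Balaban1985RegularSpaces]; [III] = [Balaban1988Convergent];
[I] = [Balaban1987RG1]; [3] = [Balaban1985Averaging].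

WHY (⚑ LOCATED-133-FAR-CELLS, dag-n07-w3 g14, pub-ymgap bus 2026-08-30 05:14Z; repair R1 by the author, dag-lead WORDS 261).  MODULE 133's displayed supplier `hJ` ended «for the
door's `(u, A)` … ⊢ `NrmSymPhiOfRecord … u A`» for THE SAME `u`.  But row 9′ of `NrmSymPhiOfRecord` (✓`…N07Thm4RecordStructureSym152Phi`) ranges over EVERY cell `LamSite j′ y` of the
domains-meet tower, and at `j′ = 0` the meet's `Om 0 = T` ([II] (2.1) «Ω₀ := T»): every fine site whose `L`-block misses `π₁″□₁ ∩ Ω₁` is a level-0 cell, where the guarded average is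
the identity (`gaugeAvgIter_zero`) and row 9′ reads `‖h̄(y)·w(y)·u(y)⁻¹ − 1‖ ≤ Ψ ε j` — while `hJ`'s antecedents constrain `u` only on `π″(cube … j 0)`.  So `hJ` as displayed in 133 is
inhabitable only vacuously.  The junction's own road (dag-n07-w3 JUNCTION-PHI-ROAD §12 (4)) routes row 9′ through the GLUED gauge `u′ := u on π″(□₀ᶻ), h̄·w_s off it` (this seat's
✓p748467 `…N07NrmSymPhiOfCoverRow.nrmSymPhiOfRecord_glued_of_coverRow` + `towers_dichotomy_image_cube_zero`); 133 dropped the glue when it pinned the witness to the door's `u`.  THIS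
FILE restores it: `hJ`'s conclusion becomes «`∃ u′`, `u′ = u` on `cover '' cube L (cornerP …) (sideP …) ρ j 0` ∧ `NrmSymPhiOfRecord … u′ A`», and the skeleton returns `(u′, A)`: rows
1–2 (the member identities on `regionOfSet (π″box)` ⊆ `regionOfSet (π″(cube … 0))`, [6] `box_subset_cube`) transfer from `u` to `u′` by ✓p748467 §4 `gaugeU_congr_of_eqOn`; rows 3–8 +
(T2b) mention `A` only.  Everything else is MODULE 133 verbatim (collar from the meeting witness, non-wrapping, `InAk` of the dented family, the dent premise, the pre-composed crown ⇒ `u₀`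
with ALL its rows, MODULE 132 ⇒ `(u, A)` + door formula + rows 1–8 + (T2b)).

WHAT IS PROVED (sorry-free; axioms standard).  ★★★ `hThm4RecSym152PhiEG_of_junction_glued`.
HONEST FRAMING: count-neutral composition; `DatumCrownPhiAt` and `hJ` are DISPLAYED premises (inhabited by nobody here); nothing of [15]∕[6]∕[III]∕[I]∕[3] asserted beyond the cited
modules; `HThm4RecSym152PhiEG` is NOT discharged by this file (it is its conclusion UNDER `hJ`); `HThm4Rec*` UNDISCHARGED; N05 ∕ N07 NOT discharged; K0⁷ ∕ K1⁹ NOT closed; counts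
unmoved (typed 28∕28 · discharged 8∕28); R4 closes the conditional finite-𝕋⁴ rung `BalabanLadder.UV` ONLY; the YM mass gap (Clay) is NOT proved; nothing continuum ∕ ℝ⁴ ∕ OS.  No `def`,
no `instance`, no `notation`, no `sorry`.

References: [15] (144) p. 300, (147)–(153) p. 301; [6] Thm. 4 p. 88, Prop. 6 (1.130)–(1.138) pp. 98–99, (1.29) p. 81; [III] (2.1)–(2.2) p. 254, (2.5) p. 255; [I] (0.1) p. 251,
(0.3)–(0.4) pp. 252–253; [3] (78)–(81) p. 30; [II] = [Balaban1984PropagatorsII] (2.1) p. 224.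
-/

set_option autoImplicit false

noncomputable section

open scoped BigOperators Matrix.Norms.L2Operator

namespace Summit.QuantumFields.YangMills.BalabanUVNodes.N07Thm4RecSym152PhiEGOfJunctionGlued

open Literature.MathematicalPhysics.QuantumFieldTheory.Balaban1983to89
open Literature.MathematicalPhysics.QuantumFieldTheory.Balaban1983to89.Node00
open Literature.MathematicalPhysics.QuantumFieldTheory.Balaban1983to89.B12RegularSpaces111 (gaugeU expI grad)
open B15Eq112TorusCover (cover)
open B14DomainGeom (Pt Within)
open B8Eq131Cubes (box cube tcube tLo tHi)
open B8Eq131CubesRec (tcubeZ bLoZ bHiZ)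
open B6SectAOperatorsV1 (RE dsE)
open B7Prop1Explicit (e gaugeAct)
open B7Prop1Local (AgreeOn InBox)
open B7Prop2SpecialUnitary (specialUnitaryUnits)
open BlockAveragingZd (avgIterZ ctrShift)
open B8Ineq132 (covDerivFwd InAk)
open B8Eq140Level (SideTouches)
open B8Eq138LandauZd (logCfg covLap)
open B8Eq138LandauZdRec (IsLandau138WZ)
open B8Eq119TwistedAxialRec (Restr129Z UnderZ)
open B7SectEFLinearisationRec (logCovIterZ)
open B8Eq184Proof (cfgExp)
open B8ScaledSupNorm (msup bondNorm)
open B8Eq146AExpansion (plaqCovDeriv iEta)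
open B8Eq143PlaqExpansion (pdiv)
open B7AvgGaugeCovariance (uLev)
open MatrixLog (mlog)
open Literature.MathematicalPhysics.QuantumFieldTheory.BalabanImbrieJaffe1984to88.BIJ85AxialPropagator411 (BondSpace)
open T4Continuum (T4Family)
open N07Thm4RecMemberOfCrown (sitesPerDir_anti)
open N07DatumCrownPhiOfRecordCrownPrecomp (DatumCrownPhiAt)
open N07Thm4RecordStructureSym152Phi (NrmSymPhiOfRecord)
open N07Thm4RecordStructureSym152PhiEG (HThm4RecSym152PhiEG)
open N07Thm4Rows152OfDatumCrownPhiAt (inAk_dentFamZ_of_tcubeZ)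
open N07Thm4Rows152OfRecordDoorRows (rows152_of_recordDoorRows)
open N07NrmSymPhiOfCoverRow (gaugeU_congr_of_eqOn)

variable (F : T4Family) (N : ℕ) [NeZero N]

set_option maxHeartbeats 800000 in
/-- ★★★ **THE ASSEMBLY SKELETON**: `DatumCrownPhiAt F N Mc ρ hρ s Cr Cω α₁ ω₁` (`0 ≤ Cr, Cω`, `L^{s+1} ∣ ρ`, `L³·a₀ ≤ α₁`) and the junction's per-datum supplier `hJ` — given the
datum of the def of record, its collar `π(□̃) ⊆ Ω_{j−1}`, the non-wrapping of `□̃` and `𝔄_j` at `α := L³ε_{j−1}` (constant and dented families), a choice of `(h, X, ω)` with: `h` SU-valued and `= 1` off `□₀ᶻ`, block-constancy under the dented cells, `0 ≤ ω ≤ ω₁`,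
the two oscillation rows, the numerics `2·r·t < κ·ε_j` (`t ≤ L⁴`) and `4·N·r < 2π` at `r := Cr·(L³ε_{j−1}) + Cω·ω`, and the map «crown output `u₀` with ALL its rows ⇒ door output
`(u, A)` with the door formula at `h⁻¹·u₀` and rows 1–8 + (T2b) ⇒ row 9′ `NrmSymPhiOfRecord … (Ψ ε j) … u′ A` FOR SOME GAUGE `u′` AGREEING WITH `u` ON `π″(□₀) = cover '' cube … j 0`»
(the GLUED edition of MODULE 133's `hJ`, ⚑ LOCATED-133-FAR-CELLS) — give `HThm4RecSym152PhiEG F N Mc ρ (L^{s+1}) κ a₀ Ψ` (witness `(u′, A)`; rows 1–2 move from `u` to `u′` by `gaugeU_congr_of_eqOn`).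
[cite: Balaban1985Variational, (144) p.300, (147)–(153) p.301; Balaban1985RegularSpaces, Thm. 4 p.88, Prop. 6 (1.130)–(1.138) p.99, (1.29) p.81; Balaban1988Convergent, (2.1)–(2.2) p.254, (2.5) p.255; Balaban1987RG1, (0.1) p.251, (0.3)–(0.4) pp.252–253; Balaban1985Averaging, (78)–(81) p.30] -/
theorem hThm4RecSym152PhiEG_of_junction_glued {Mc ρ : ℕ} (hρ : F.L ≤ ρ) {s : ℕ} {Cr Cω α₁ ω₁ κ a₀ : ℝ} {Ψ : (ℕ → ℝ) → ℕ → ℝ} (hCr : 0 ≤ Cr) (hCω : 0 ≤ Cω)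
    (hcrown : DatumCrownPhiAt F N Mc ρ hρ s Cr Cω α₁ ω₁) (hsρ : F.L ^ (s + 1) ∣ ρ) (hα : (F.L : ℝ) ^ 3 * a₀ ≤ α₁)
    (hJ : ∀ (ν : Stage7Numerics) (M : ℕ) (g : ℕ → ℝ) (K k : ℕ) (sq : SeqOfRecord F ν M g K k), Sect2.SeqSeparated ν.M₁ sq → 0 < ν.M₁ →
      (11 * 4 + 4 * ρ + Mc + 3) * F.L ≤ ν.M₁ → Mc + 11 * 4 + 6 * ρ ≤ (F.P K).sitesPerDir k → 1 ≤ k →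
      (∀ i : ℕ, 1 ≤ i → i ≤ k →
        F.L ^ (s + 1) ∣ M * RkOfRecord (F.P K).L ν.r (g i) ∧ dCubeSide (F.P K).L M (RkOfRecord (F.P K).L ν.r (g i)) i ∣ (F.P K).sitesPerDir 0) →
      ∀ (ε : ℕ → ℝ), (∀ n, n ≤ k → 0 < ε n ∧ ε n ≤ a₀) → (∀ n, n < k → ε n ≤ 2 * ε (n + 1)) →
      ∀ U : GaugeField (F.P K) 0 (SU N),
      (∀ n, n ≤ k → PlaqSmallOn (Sect2.omegaPlaqsTop sq.Ω (suppDomOfRecord F ν K sq.Ω) n) (ε n * (F.P K).eta n ^ 2) U) →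
      (∀ n, n ≤ k → Sect2.CoDivSmallOn (Sect2.omegaBondsTop sq.Ω (suppDomOfRecord F ν K sq.Ω) n) (ε n * (F.P K).eta n ^ 3) U) →
      ∀ (j : ℕ) (hk : j ≤ (F.P K).m + (F.P K).K) (hj1 : 1 ≤ j), j ≤ k → ∀ (idx : Pt (F.P K).d),
      (∃ x ∈ box (F.P K).L (cornerP (F.P K) Mc ρ idx) (sideP (F.P K) Mc ρ) j, ∃ y : Pt (F.P K).d, cover (F.P K) y ∈ sq.Ω j ∧ Within ((3 : ℕ) : ℤ) x y) →
      letI : CStarAlgebra (MatA N) := {};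
      -- GIVEN the collar `π(□̃) ⊆ Ω_{j−1}` of the datum …
      cover (F.P K) '' tcube (F.P K).L (cornerP (F.P K) Mc ρ idx) (sideP (F.P K) Mc ρ) ρ j ⊆
          (if j - 1 = 0 then suppDomOfRecord F ν K sq.Ω else sq.Ω (j - 1)) →
      -- … the non-wrapping of `□̃` and the axial smallness `𝔄_j` at `α := L³·ε_{j−1}` (constant family `□̃ᶻ` AND the dented family) …
      Set.InjOn (cover (F.P K)) (tcube (F.P K).L (cornerP (F.P K) Mc ρ idx) (sideP (F.P K) Mc ρ) ρ j) →
      InAk (F.P K).L j ((F.P K).eta j) (((F.P K).L : ℝ) ^ 3 * ε (j - 1))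
          (fun _ => tcubeZ (F.P K).L (cornerP (F.P K) Mc ρ idx) (sideP (F.P K) Mc ρ) ρ j) (fun x μ => ιSU N (U ⟨cover (F.P K) (x + fun _ => (ctrShift (F.P K).L j : ℤ)), μ⟩)) →
      InAk (F.P K).L j ((F.P K).eta j) (((F.P K).L : ℝ) ^ 3 * ε (j - 1)) (dentFamZ (F.P K) j Mc ρ idx ((domainsOfSeq sq.Ω j hk).Om j)) (fun x μ => ιSU N (U ⟨cover (F.P K) (x + fun _ => (ctrShift (F.P K).L j : ℤ)), μ⟩)) →
      -- … the junction CHOOSES `h`, `X`, `ω` with the crown's input rows and the numerics at `r := Cr·(L³ε_{j−1}) + Cω·ω` …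
      ∃ (h : B7Prop1Explicit.Site (F.P K).d → (MatA N)ˣ) (X : ℕ → B7Prop1Explicit.Site (F.P K).d → (MatA N)ˣ) (ω : ℝ),
        (∀ x, h x ∈ specialUnitaryUnits (Fin N)) ∧ (∀ x, x ∉ (recordCubePZ (F.P K) j hj1 hk Mc ρ hρ idx ((domainsOfSeq sq.Ω j hk).Om j)).sq 0 → h x = 1) ∧
        (∀ j', 1 ≤ j' → j' ≤ j → ∀ y ∈ (recordCubePZ (F.P K) j hj1 hk Mc ρ hρ idx ((domainsOfSeq sq.Ω j hk).Om j)).lamS j', ∀ x, UnderZ (F.P K).L j' y x → h x = X j' y) ∧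
        0 ≤ ω ∧ ω ≤ ω₁ ∧
        (∀ j', j' ≤ j → ∀ (z : B7Prop1Explicit.Site (F.P K).d) (μ : Fin (F.P K).d),
          (∀ x, InBox (fun i => ((F.P K).L : ℤ) ^ j' * z i - (ctrShift (F.P K).L j' : ℤ))
              (fun i => ((F.P K).L : ℤ) ^ j' * z i + (ctrShift (F.P K).L j' : ℤ) + if i = μ then ((F.P K).L : ℤ) ^ j' else 0) x →
            x ∈ (recordCubePZ (F.P K) j hj1 hk Mc ρ hρ idx ((domainsOfSeq sq.Ω j hk).Om j)).sq (j' - 1)) →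
          ‖((uLev (F.P K).L h j' z : (MatA N)ˣ) : MatA N) - ((uLev (F.P K).L h j' (z + e μ) : (MatA N)ˣ) : MatA N)‖ ≤ ω) ∧
        (∀ b ∈ {b : B7Prop1Explicit.Site (F.P K).d × Fin (F.P K).d | SideTouches ((recordCubePZ (F.P K) j hj1 hk Mc ρ hρ idx ((domainsOfSeq sq.Ω j hk).Om j)).sq 0) b.1 b.2},
          ‖((h b.1 : (MatA N)ˣ) : MatA N) - ((h (b.1 + e b.2) : (MatA N)ˣ) : MatA N)‖ ≤ ω) ∧
        (∀ t : ℝ, 0 ≤ t → t ≤ ((F.P K).L : ℝ) ^ 4 → 2 * ((Cr * (((F.P K).L : ℝ) ^ 3 * ε (j - 1)) + Cω * ω) * t) < κ * ε j) ∧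
        4 * ((N : ℝ) * (Cr * (((F.P K).L : ℝ) ^ 3 * ε (j - 1)) + Cω * ω)) < 2 * Real.pi ∧
        -- … and, for the crown's output `u₀` with ALL its rows (VERBATIM `DatumCrownPhiAt`) and the door's `(u, A)` with the door formula and rows 1–8 + (T2b), SUPPLIES row 9′
        ∀ u₀ : B7Prop1Explicit.Site (F.P K).d → (MatA N)ˣ,
            (∀ x, u₀ x ∈ specialUnitaryUnits (Fin N)) ∧
              (∀ x, x ∉ (recordCubePZ (F.P K) j hj1 hk Mc ρ hρ idx ((domainsOfSeq sq.Ω j hk).Om j)).sq 0 → u₀ x = 1) ∧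
              Restr129Z (F.P K).L j (recordCubePZ (F.P K) j hj1 hk Mc ρ hρ idx ((domainsOfSeq sq.Ω j hk).Om j)).lamS (1 : B7Prop1Explicit.Site (F.P K).d → Fin (F.P K).d → (MatA N)ˣ) u₀ ∧
              IsLandau138WZ (F.P K).L j ((F.P K).eta j) ((recordCubePZ (F.P K) j hj1 hk Mc ρ hρ idx ((domainsOfSeq sq.Ω j hk).Om j)).sq 0) (recordCubePZ (F.P K) j hj1 hk Mc ρ hρ idx ((domainsOfSeq sq.Ω j hk).Om j)).lamS
                (1 : B7Prop1Explicit.Site (F.P K).d → Fin (F.P K).d → (MatA N)ˣ)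
                ((recordCubePZ (F.P K) j hj1 hk Mc ρ hρ idx ((domainsOfSeq sq.Ω j hk).Om j)).fixed (fun x μ => ιSU N (U ⟨cover (F.P K) (x + fun _ => (ctrShift (F.P K).L j : ℤ)), μ⟩)) (h⁻¹ * u₀)) ∧
              (∀ j', j' ≤ j → ∀ b ∈ {b : B7Prop1Explicit.Site (F.P K).d × Fin (F.P K).d | SideTouches ((recordCubePZ (F.P K) j hj1 hk Mc ρ hρ idx ((domainsOfSeq sq.Ω j hk).Om j)).sq j') b.1 b.2},
                (recordCubePZ (F.P K) j hj1 hk Mc ρ hρ idx ((domainsOfSeq sq.Ω j hk).Om j)).fixed (fun x μ => ιSU N (U ⟨cover (F.P K) (x + fun _ => (ctrShift (F.P K).L j : ℤ)), μ⟩)) (h⁻¹ * u₀) b.1 b.2 =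
                    cfgExp ((F.P K).eta j) (logCfg ((F.P K).eta j) ((recordCubePZ (F.P K) j hj1 hk Mc ρ hρ idx ((domainsOfSeq sq.Ω j hk).Om j)).fixed
                      (fun x μ => ιSU N (U ⟨cover (F.P K) (x + fun _ => (ctrShift (F.P K).L j : ℤ)), μ⟩)) (h⁻¹ * u₀))) b.1 b.2 ∧
                  IsSelfAdjoint (logCfg ((F.P K).eta j) ((recordCubePZ (F.P K) j hj1 hk Mc ρ hρ idx ((domainsOfSeq sq.Ω j hk).Om j)).fixed
                      (fun x μ => ιSU N (U ⟨cover (F.P K) (x + fun _ => (ctrShift (F.P K).L j : ℤ)), μ⟩)) (h⁻¹ * u₀)) b.1 b.2) ∧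
                  ‖logCfg ((F.P K).eta j) ((recordCubePZ (F.P K) j hj1 hk Mc ρ hρ idx ((domainsOfSeq sq.Ω j hk).Om j)).fixed
                      (fun x μ => ιSU N (U ⟨cover (F.P K) (x + fun _ => (ctrShift (F.P K).L j : ℤ)), μ⟩)) (h⁻¹ * u₀)) b.1 b.2‖ ≤
                    (Cr * (((F.P K).L : ℝ) ^ 3 * ε (j - 1)) + Cω * ω) * (((F.P K).L : ℝ) ^ j' * (F.P K).eta j)⁻¹) ∧
              (∀ x, (((recordCubePZ (F.P K) j hj1 hk Mc ρ hρ idx ((domainsOfSeq sq.Ω j hk).Om j)).vfix (fun x μ => ιSU N (U ⟨cover (F.P K) (x + fun _ => (ctrShift (F.P K).L j : ℤ)), μ⟩)))⁻¹ * (h⁻¹ * u₀)) x ∈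
                specialUnitaryUnits (Fin N)) ∧
              AgreeOn (B8Ineq130Rec.tlo (F.P K).L (tLo (cornerP (F.P K) Mc ρ idx) ρ) j) (B8Ineq130Rec.thi (F.P K).L (tHi (cornerP (F.P K) Mc ρ idx) (sideP (F.P K) Mc ρ) ρ) j)
                (gaugeAct (((recordCubePZ (F.P K) j hj1 hk Mc ρ hρ idx ((domainsOfSeq sq.Ω j hk).Om j)).vfix (fun x μ => ιSU N (U ⟨cover (F.P K) (x + fun _ => (ctrShift (F.P K).L j : ℤ)), μ⟩)))⁻¹ * (h⁻¹ * u₀))⁻¹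
                  (fun x μ => ιSU N (U ⟨cover (F.P K) (x + fun _ => (ctrShift (F.P K).L j : ℤ)), μ⟩)))
                ((recordCubePZ (F.P K) j hj1 hk Mc ρ hρ idx ((domainsOfSeq sq.Ω j hk).Om j)).fixed (fun x μ => ιSU N (U ⟨cover (F.P K) (x + fun _ => (ctrShift (F.P K).L j : ℤ)), μ⟩)) (h⁻¹ * u₀)) ∧
              msup (F.P K).L j ((F.P K).eta j) (-(2 : ℝ))
                  (fun j' (q : Fin (F.P K).d × Fin (F.P K).d × B7Prop1Explicit.Site (F.P K).d) => SideTouches ((recordCubePZ (F.P K) j hj1 hk Mc ρ hρ idx ((domainsOfSeq sq.Ω j hk).Om j)).sq j') q.2.2 q.2.1)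
                  (fun q => covDerivFwd ((F.P K).eta j) (1 : B7Prop1Explicit.Site (F.P K).d → Fin (F.P K).d → (MatA N)ˣ) q.1
                    (fun z => (recordCubePZ (F.P K) j hj1 hk Mc ρ hρ idx ((domainsOfSeq sq.Ω j hk).Om j)).expo ((F.P K).eta j)
                      (fun x μ => ιSU N (U ⟨cover (F.P K) (x + fun _ => (ctrShift (F.P K).L j : ℤ)), μ⟩)) (h⁻¹ * u₀) z q.2.1) q.2.2) ≤ Cr * (((F.P K).L : ℝ) ^ 3 * ε (j - 1)) + Cω * ω ∧
              bondNorm (F.P K).L j ((F.P K).eta j) (-(3 : ℝ)) (recordCubePZ (F.P K) j hj1 hk Mc ρ hρ idx ((domainsOfSeq sq.Ω j hk).Om j)).sq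
                  (fun x μ => pdiv ((F.P K).eta j) (1 : B7Prop1Explicit.Site (F.P K).d → Fin (F.P K).d → (MatA N)ˣ)
                    (plaqCovDeriv ((F.P K).eta j) (1 : B7Prop1Explicit.Site (F.P K).d → Fin (F.P K).d → (MatA N)ˣ)
                      ((recordCubePZ (F.P K) j hj1 hk Mc ρ hρ idx ((domainsOfSeq sq.Ω j hk).Om j)).expo ((F.P K).eta j)
                        (fun x μ => ιSU N (U ⟨cover (F.P K) (x + fun _ => (ctrShift (F.P K).L j : ℤ)), μ⟩)) (h⁻¹ * u₀))) μ x) ≤ Cr * (((F.P K).L : ℝ) ^ 3 * ε (j - 1)) + Cω * ω ∧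
              bondNorm (F.P K).L j ((F.P K).eta j) (-(3 : ℝ)) (recordCubePZ (F.P K) j hj1 hk Mc ρ hρ idx ((domainsOfSeq sq.Ω j hk).Om j)).sq
                  (fun x μ => covLap ((F.P K).eta j) (1 : B7Prop1Explicit.Site (F.P K).d → Fin (F.P K).d → (MatA N)ˣ)
                    (fun z => (recordCubePZ (F.P K) j hj1 hk Mc ρ hρ idx ((domainsOfSeq sq.Ω j hk).Om j)).expo ((F.P K).eta j)
                      (fun x μ => ιSU N (U ⟨cover (F.P K) (x + fun _ => (ctrShift (F.P K).L j : ℤ)), μ⟩)) (h⁻¹ * u₀) z μ) x) ≤ Cr * (((F.P K).L : ℝ) ^ 3 * ε (j - 1)) + Cω * ω ∧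
              (∀ (x : B7Prop1Explicit.Site (F.P K).d) (μ : Fin (F.P K).d),
                bLoZ (F.P K).L (cornerP (F.P K) Mc ρ idx) 0 0 ≤ x → x + e μ ≤ bHiZ (F.P K).L (cornerP (F.P K) Mc ρ idx) (sideP (F.P K) Mc ρ) 0 0 →
                (recordCubePZ (F.P K) j hj1 hk Mc ρ hρ idx ((domainsOfSeq sq.Ω j hk).Om j)).inTop x → (recordCubePZ (F.P K) j hj1 hk Mc ρ hρ idx ((domainsOfSeq sq.Ω j hk).Om j)).inTop (x + e μ) →
                logCovIterZ (F.P K).L (1 : B7Prop1Explicit.Site (F.P K).d → Fin (F.P K).d → (MatA N)ˣ)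
                    (iEta ((F.P K).eta j) ((recordCubePZ (F.P K) j hj1 hk Mc ρ hρ idx ((domainsOfSeq sq.Ω j hk).Om j)).expo ((F.P K).eta j)
                      (fun x μ => ιSU N (U ⟨cover (F.P K) (x + fun _ => (ctrShift (F.P K).L j : ℤ)), μ⟩)) (h⁻¹ * u₀))) j x μ =
                  mlog ((avgIterZ (F.P K).L (gaugeAct h ((recordCubePZ (F.P K) j hj1 hk Mc ρ hρ idx ((domainsOfSeq sq.Ω j hk).Om j)).axial
                    (fun x μ => ιSU N (U ⟨cover (F.P K) (x + fun _ => (ctrShift (F.P K).L j : ℤ)), μ⟩)))) j x μ : (MatA N)ˣ) : MatA N)) →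
        ∀ (u : GaugeTransf (F.P K) 0 (SU N)) (A : PBond (F.P K) 0 → MatA N),
            -- the door formula on `□₀ᶻ`
            (∀ x, x ∈ (recordCubePZ (F.P K) j hj1 hk Mc ρ hρ idx ((domainsOfSeq sq.Ω j hk).Om j)).sq 0 → ιSU N (u (cover (F.P K) (x + fun _ => (ctrShift (F.P K).L j : ℤ)))) = ((h⁻¹ * u₀) x)⁻¹ * (recordCubePZ (F.P K) j hj1 hk Mc ρ hρ idx ((domainsOfSeq sq.Ω j hk).Om j)).vfix (fun x μ => ιSU N (U ⟨cover (F.P K) (x + fun _ => (ctrShift (F.P K).L j : ℤ)), μ⟩)) x) ∧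
            -- rows 1–8 + (T2b) of `HThm4RecSym152PhiEG` for `(u, A)`
            (∀ b ∈ (Sect2.regionOfSet (F.P K) (cover (F.P K) '' box (F.P K).L (cornerP (F.P K) Mc ρ idx) (sideP (F.P K) Mc ρ) j)).bonds,
              gaugeU (fun x => ιSU N (u x)) (fun b' => ιSU N (U b')) b = expI ((F.P K).eta j) (A b)) ∧
            (∀ b ∈ (Sect2.regionOfSet (F.P K) (cover (F.P K) '' cube (F.P K).L (cornerP (F.P K) Mc ρ idx) (sideP (F.P K) Mc ρ) ρ j 0)).bonds,
              gaugeU (fun x => ιSU N (u x)) (fun b' => ιSU N (U b')) b = expI ((F.P K).eta j) (A b)) ∧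
            (∀ j', j' ≤ j →
              ∀ b ∈ (Sect2.regionOfSet (F.P K) (cover (F.P K) '' cube (F.P K).L (cornerP (F.P K) Mc ρ idx) (sideP (F.P K) Mc ρ) ρ j j')).bonds,
                ‖A b‖ < κ * ε j * ((F.P K).L : ℝ) ^ (j - j')) ∧
            (∀ j', j' ≤ j →
              ∀ q ∈ (Sect2.regionOfSet (F.P K) (cover (F.P K) '' cube (F.P K).L (cornerP (F.P K) Mc ρ idx) (sideP (F.P K) Mc ρ) ρ j j')).dpairs,
                ‖grad ((F.P K).eta j) q.2.1 (fun y => A ⟨y, q.2.2⟩) q.1‖ < κ * ε j * ((F.P K).L : ℝ) ^ (2 * (j - j'))) ∧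
            (∀ b ∈ (Sect2.regionOfSet (F.P K) (cover (F.P K) '' box (F.P K).L (cornerP (F.P K) Mc ρ idx) (sideP (F.P K) Mc ρ) j)).bonds,
              ‖A b‖ < κ * ε j) ∧
            (∀ q ∈ (Sect2.regionOfSet (F.P K) (cover (F.P K) '' box (F.P K).L (cornerP (F.P K) Mc ρ idx) (sideP (F.P K) Mc ρ) j)).dpairs,
              ‖grad ((F.P K).eta j) q.2.1 (fun y => A ⟨y, q.2.2⟩) q.1‖ < κ * ε j) ∧
            (∀ b ∈ Sect2.bondsDeep (cover (F.P K) '' box (F.P K).L (cornerP (F.P K) Mc ρ idx) (sideP (F.P K) Mc ρ) j),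
              ‖Sect2.codiffCurlA ((F.P K).eta j) A b.src b.dir‖ < κ * ε j) ∧
            (∀ b ∈ Sect2.bondsDeep (cover (F.P K) '' box (F.P K).L (cornerP (F.P K) Mc ρ idx) (sideP (F.P K) Mc ρ) j),
              ‖∑ ν' : Fin (F.P K).d, (((F.P K).eta j : ℝ) : ℂ)⁻¹ •
                  (grad ((F.P K).eta j) ν' (fun y => A ⟨y, b.dir⟩) (b.src.unshift ν') - grad ((F.P K).eta j) ν' (fun y => A ⟨y, b.dir⟩) b.src)‖ < κ * ε j) ∧
            (∀ φ : MatA N →L[ℂ] ℂ,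
              RE (domainsMeet (cubeDomains (F.P K) (cornerP (F.P K) Mc ρ idx) (sideP (F.P K) Mc ρ) ρ j hk) (domainsOfSeq sq.Ω j hk)) ((F.P K).eta j)⁻¹
                  (dsE ((F.P K).eta j)⁻¹ (WithLp.toLp 2 fun b => (φ (A b)).re : BondSpace (F.P K))) = 0 ∧
              RE (domainsMeet (cubeDomains (F.P K) (cornerP (F.P K) Mc ρ idx) (sideP (F.P K) Mc ρ) ρ j hk) (domainsOfSeq sq.Ω j hk)) ((F.P K).eta j)⁻¹
                  (dsE ((F.P K).eta j)⁻¹ (WithLp.toLp 2 fun b => (φ (A b)).im : BondSpace (F.P K))) = 0) →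
        ∃ u' : GaugeTransf (F.P K) 0 (SU N),
          (∀ x ∈ cover (F.P K) '' cube (F.P K).L (cornerP (F.P K) Mc ρ idx) (sideP (F.P K) Mc ρ) ρ j 0, u' x = u x) ∧
          NrmSymPhiOfRecord F N Mc ρ (Ψ ε j) ν M g K k sq U j idx u' A) :
    HThm4RecSym152PhiEG F N Mc ρ (F.L ^ (s + 1)) κ a₀ Ψ := by
  intro _ ν M g K k sq hsep hM₁ hfl hnw hk1 hgrid ε hε hcomp U hP hD j hk hj1 hjk idx hmeet
  letI : CStarAlgebra (MatA N) := {}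
  -- ### the collar inclusion from the meeting witness (as in ✓p745548 ∕ MODULE 129)
  obtain ⟨x, hx, y, hy, hxy⟩ := id hmeet
  have hcollar : cover (F.P K) '' tcube (F.P K).L (cornerP (F.P K) Mc ρ idx) (sideP (F.P K) Mc ρ) ρ j ⊆
      (if j - 1 = 0 then suppDomOfRecord F ν K sq.Ω else sq.Ω (j - 1)) := by
    rcases Nat.lt_or_ge j 2 with hj2 | hj2
    · have hj1' : j = 1 := by omega
      subst hj1'
      rw [if_pos rfl, suppDomOfRecord_eq]
      rintro _ ⟨z, hz, rfl⟩
      have hz' : z ∈ (cubeIdxP' (F.P K) 1 le_rfl Mc ρ idx).Ω 0 := by rw [cubeIdxP'_Ω]; exact hz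
      have hw := within_of_mem_Ω_cubeIdxP'_of_within_box (P := F.P K) le_rfl hx hxy hz'
      refine cover_mem_hullD_one_of_within hM₁ hy (hw.mono ?_)
      rw [B14.Eq213MaximalDomains.side, pow_one, T4Family.P_d, T4Family.P_L]
      have hf : (((11 * 4 + 4 * ρ + Mc + 3) * F.L : ℕ) : ℤ) ≤ ν.M₁ := by exact_mod_cast hfl
      have hL1z : (1 : ℤ) ≤ F.L := by exact_mod_cast (F.P 0).L_pos
      push_cast at hf ⊢
      nlinarith
    · rw [if_neg (by omega)]
      have hfloor : 11 * (F.P K).d + 4 * ρ + Mc + 3 ≤ ν.M₁ := by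
        rw [T4Family.P_d]
        exact le_trans (Nat.le_mul_of_pos_right _ (F.P 0).L_pos) hfl
      have h := Sect2.cover_image_Ω_cubeIdxP'_subset_of_within_mem_box (P := F.P K) hM₁ sq hsep hfloor hj2 hjk hx hy hxy 0
      rwa [cubeIdxP'_Ω] at h
  -- ### the non-wrapping of `□̃` from the guard; `InAk` of the constant family ⇒ of the dented family (antitonicity)
  have hg : Mc + 11 * (F.P K).d + 6 * ρ ≤ (F.P K).sitesPerDir j := by
    rw [T4Family.P_d]; exact hnw.trans (sitesPerDir_anti (F.P K) hjk)
  have hinj := injOn_cover_tcube_of_guard (P := F.P K) (a := idx) hk hg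
  have hεj1 : 0 < ε (j - 1) := (hε (j - 1) (by omega)).1
  have hL3 : (0 : ℝ) < (F.L : ℝ) ^ 3 := pow_pos (by exact_mod_cast (F.P 0).L_pos) 3
  have hαpos : 0 < ((F.P K).L : ℝ) ^ 3 * ε (j - 1) := by rw [T4Family.P_L]; exact mul_pos hL3 hεj1
  have hαle : ((F.P K).L : ℝ) ^ 3 * ε (j - 1) ≤ α₁ := by
    rw [T4Family.P_L]; exact (mul_le_mul_of_nonneg_left (hε (j - 1) (by omega)).2 hL3.le).trans hα
  have hηpos : 0 < (F.P K).eta j := B3GkZeroTorusRescaled.eta_pos (F.P K) j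
  have hInAk0 : InAk (F.P K).L j ((F.P K).eta j) (((F.P K).L : ℝ) ^ 3 * ε (j - 1))
      (fun _ => tcubeZ (F.P K).L (cornerP (F.P K) Mc ρ idx) (sideP (F.P K) Mc ρ) ρ j) (fun x μ => ιSU N (U ⟨cover (F.P K) (x + fun _ => (ctrShift (F.P K).L j : ℤ)), μ⟩)) :=
    inAk_coverLiftShift_tcubeZ_of_top N U hP hD (cornerP (F.P K) Mc ρ idx) (sideP (F.P K) Mc ρ) ρ j hηpos (fun _ => j - 1) (fun _ _ => by omega)
      (fun _ _ => hcollar) (fun j' hj' => (tol_of_level_pred (F.P K) hj1 hεj1.le hj').1) (fun j' hj' => (tol_of_level_pred (F.P K) hj1 hεj1.le hj').2)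
  have hInAk : InAk (F.P K).L j ((F.P K).eta j) (((F.P K).L : ℝ) ^ 3 * ε (j - 1)) (dentFamZ (F.P K) j Mc ρ idx ((domainsOfSeq sq.Ω j hk).Om j)) (fun x μ => ιSU N (U ⟨cover (F.P K) (x + fun _ => (ctrShift (F.P K).L j : ℤ)), μ⟩)) :=
    inAk_dentFamZ_of_tcubeZ hInAk0
  -- ### the junction's choice for this datum
  obtain ⟨h, X, ω, hSU, hh1, hconst, hω0, hω1, hoscj, hosc0, hbud, h4, hrow9⟩ :=
    hJ ν M g K k sq hsep hM₁ hfl hnw hk1 hgrid ε hε hcomp U hP hD j hk hj1 hjk idx hmeet hcollar hinj hInAk0 hInAk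
  -- ### the dent premise
  have hdent := dentFamZ_top_superblockSaturated_seqOfRecord F ν M g K k sq hk hj1 hjk (e := s) (hgrid j hj1 hjk) Mc ρ hsρ idx
  -- ### the pre-composed crown ⇒ `u₀` with ALL its rows
  obtain ⟨u₀, hB⟩ := hcrown K U j hj1 hk idx ((domainsOfSeq sq.Ω j hk).Om j) hdent _ hαpos hαle hInAk h hSU X hconst ω hω0 hω1 hoscj hosc0
  obtain ⟨hu₀, hoff₀, -, hLanW, hrows, hsuW, hagree, hmsup, hbn1, hbn2, -⟩ := id hB
  -- ### MODULE 132 ⇒ the door's `(u, A)`, door formula, rows 1–8 + (T2b)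
  have hr : 0 ≤ Cr * (((F.P K).L : ℝ) ^ 3 * ε (j - 1)) + Cω * ω := by positivity
  have hbud' : ∀ t : ℝ, 0 ≤ t → t ≤ (F.L : ℝ) ^ 4 → 2 * ((Cr * (((F.P K).L : ℝ) ^ 3 * ε (j - 1)) + Cω * ω) * t) < κ * ε j :=
    fun t ht htL => hbud t ht (by rw [T4Family.P_L]; exact htL)
  obtain ⟨-, u, A, hR⟩ := rows152_of_recordDoorRows F N hρ ν M g K k sq hsep hM₁ hfl hnw ε U j hk hj1 hjk idx hmeet h hSU hh1 u₀ hu₀ hoff₀ hr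
    hLanW hrows hsuW hagree hmsup hbn1 hbn2 hbud' h4
  obtain ⟨-, h1, hT1, h3, hT2b, h4r, h5, h6, h7, h8⟩ := id hR
  -- ### the GLUE: row 9′ for some `u′ = u` on `π″(□₀)`; rows 1–2 transfer to `u′` (both ends of their bonds lie in `π″(□₀) ⊇ π″box`)
  obtain ⟨u', hu', hrow9'⟩ := hrow9 u₀ hB u A hR
  have hu'box : ∀ x ∈ cover (F.P K) '' box (F.P K).L (cornerP (F.P K) Mc ρ idx) (sideP (F.P K) Mc ρ) j, u' x = u x :=
    fun x hx => hu' x (Set.image_mono (B8Eq131Cubes.box_subset_cube (Nat.zero_le j)) hx)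
  refine ⟨u', A, fun b hb => ?_, fun b hb => ?_, h3, hT2b, h4r, h5, h6, h7, h8, hrow9'⟩
  · rw [gaugeU_congr_of_eqOn (N := N) hu'box (fun b' => ιSU N (U b')) hb]; exact h1 b hb
  · rw [gaugeU_congr_of_eqOn (N := N) hu' (fun b' => ιSU N (U b')) hb]; exact hT1 b hb

end Summit.QuantumFields.YangMills.BalabanUVNodes.N07Thm4RecSym152PhiEGOfJunctionGlued

end
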